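import Summits.MatrixMultiplication.MatrixMultiplication.Theorems.SubgroupIdentityDesigns.Negative.RectangleLaw

/-!
# The rectangle law, II: lower cells and the half-turn law (negative lemmas for the crux
# `SubgroupIdentityDesigns`, stmt-MatrixMultiplication-14079) — VALUE = THEOREM (all p, explicit
# certificate), NOT summit progress; the crux stays open.

(1) The lower-triangular twin of `RectangleLaw`: cells `{[[α, 0],[y, β]]}`, level-1 sums
`p·[M₀₁ = 0]·ψ(M₀₀α + M₁₁β)`, the non-zero rectangle annihilator `exists_lrect_annihilator`, the
cell lemmas `lcell_of_left/right` (`U⁻` in either factor) and the three placements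
`no_idTest_lrect₁₂/₁₃/₂₃` — needed for the second `p`-member `K₂ ≤ B⁻` of a Borel frame.

(2) THE HALF-TURN LAW (`no_levelOne_design_halfturn₁₂/₁₃`, `p ≠ 2`): if `H₁ ⊇ U⁺` contains a
non-scalar sign `diag(1,-1)` or `diag(-1,1)` and a later member contains `-I`, the rectangle
`{±1} × {±1}` lies in `H₁Hⱼ` and there is no level-1 identity design.  This supersedes the
mixed-frame theorem of `CornerGrid` (no `U⁻` needed in the partner) and bites every third member
of even order inside `SL_2` (whose unique involution is `-I`).
-/

set_option linter.dupNamespace false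

noncomputable section

open scoped BigOperators Classical
open Summit.MatrixMultiplication.MatrixMultiplication.Theorems.LieRankDesigns.Negative
  (GLm Mat fourierFn)
open Summit.MatrixMultiplication.MatrixMultiplication.Theorems.LevelOneGL2Designs.Negative
  (levelSubmodule mem_levelSubmodule_iff levelSubmodule_bi_inv fourierFn_mem_levelSubmodule)

namespace Summit.MatrixMultiplication.MatrixMultiplication.Theorems.SubgroupIdentityDesigns.Negative

section RectangleLawLower

open Literature.Barriers.MatrixMultiplication (SubgroupTPP)

variable {p : ℕ} [hp : Fact p.Prime]

/-- Equality of lower-triangular `2 × 2` matrices is equality of the three free entries. -/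
theorem lcell_eq_iff (a c d a' c' d' : ZMod p) :
    (!![a, 0; c, d] : Mat p 2) = !![a', 0; c', d'] ↔ a = a' ∧ c = c' ∧ d = d' := by
  constructor
  · intro h
    exact ⟨by simpa using congrFun (congrFun h 0) 0, by simpa using congrFun (congrFun h 1) 0,
      by simpa using congrFun (congrFun h 1) 1⟩
  · rintro ⟨rfl, rfl, rfl⟩; rfl


/-- Level-1 sum over a lower Borel cell: `Σ_y ψ(tr(M·[[α,0],[y,β]])) = ψ(M₀₀α+M₁₁β)·p[M₀₁=0]`. -/
theorem lcell_sum (M : Mat p 2) (α β : ZMod p) :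
    ∑ y : ZMod p, ZMod.stdAddChar (Matrix.trace (M * !![α, 0; y, β])) =
      ZMod.stdAddChar (M 0 0 * α + M 1 1 * β) * (if M 0 1 = 0 then (p : ℂ) else 0) := by
  have h : ∀ y : ZMod p, Matrix.trace (M * !![α, 0; y, β]) = (M 0 0 * α + M 1 1 * β) +
      y * M 0 1 := by
    intro y
    simp [Matrix.trace, Matrix.mul_apply, Fin.sum_univ_two]
    ring
  simp_rw [h, AddChar.map_add_eq_mul, ← Finset.mul_sum, sum_psi_mul_right]


/-- **Rectangle bracket (lower).** -/
theorem lcell_bracket (M : Mat p 2) (hM : M.det = 0) (ε ε' δ δ' : ZMod p) :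
    (∑ y : ZMod p, ZMod.stdAddChar (Matrix.trace (M * !![ε, 0; y, δ])))
      - (∑ y : ZMod p, ZMod.stdAddChar (Matrix.trace (M * !![ε', 0; y, δ])))
      - (∑ y : ZMod p, ZMod.stdAddChar (Matrix.trace (M * !![ε, 0; y, δ'])))
      + (∑ y : ZMod p, ZMod.stdAddChar (Matrix.trace (M * !![ε', 0; y, δ']))) = 0 := by
  rw [lcell_sum, lcell_sum, lcell_sum, lcell_sum]
  by_cases h01 : M 0 1 = 0
  · have h : M 0 0 * M 1 1 = 0 := by
      rw [Matrix.det_fin_two, h01, zero_mul, sub_zero] at hM; exact hM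
    rcases mul_eq_zero.1 h with h0 | h0
    · simp only [h0, zero_mul, zero_add]; ring
    · simp only [h0, zero_mul, add_zero]; ring
  · simp [h01]


/-- Push-forward of a lower cell indicator through a level-1 function. -/
theorem lcell_push (α β : ZMod p) (h : α * β ≠ 0) (c : Mat p 2 → ℂ) :
    ∑ g : GLm p 2, (∑ y : ZMod p, if (g : Mat p 2) = !![α, 0; y, β] then (1 : ℂ) else 0) *
        fourierFn c g =
      ∑ M : Mat p 2, c M * ∑ y : ZMod p, ZMod.stdAddChar (Matrix.trace (M * !![α, 0; y, β])) := by
  have hdet : ∀ y : ZMod p, Matrix.det !![α, 0; y, β] ≠ 0 := by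
    intro y; rw [Matrix.det_fin_two_of]; simpa using h
  calc ∑ g : GLm p 2, (∑ y : ZMod p, if (g : Mat p 2) = !![α, 0; y, β] then (1 : ℂ) else 0) *
          fourierFn c g
      = ∑ y : ZMod p, ∑ g : GLm p 2,
          (if (g : Mat p 2) = !![α, 0; y, β] then fourierFn c g else 0) := by
        simp_rw [Finset.sum_mul, ite_mul, one_mul, zero_mul]
        rw [Finset.sum_comm]
    _ = ∑ y : ZMod p, ∑ M : Mat p 2,
          c M * ZMod.stdAddChar (Matrix.trace (M * !![α, 0; y, β])) := by
        refine Finset.sum_congr rfl fun y _ => ?_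
        rw [sum_ite_coe_eq _ (hdet y)]
        rfl
    _ = ∑ M : Mat p 2, c M * ∑ y : ZMod p,
          ZMod.stdAddChar (Matrix.trace (M * !![α, 0; y, β])) := by
        rw [Finset.sum_comm]
        refine Finset.sum_congr rfl fun M _ => ?_
        rw [Finset.mul_sum]


/-- **THE LOWER RECTANGLE ANNIHILATOR** (cells `{[[α, 0],[y, β]]}`). -/
theorem exists_lrect_annihilator {ε ε' δ δ' : ZMod p} (hε : ε ≠ 0) (hε' : ε' ≠ 0) (hδ : δ ≠ 0)
    (hδ' : δ' ≠ 0) (hεε' : ε ≠ ε') (hδδ' : δ ≠ δ') :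
    ∃ lam : GLm p 2 → ℂ, lam ≠ 0 ∧
      (∀ g, lam g ≠ 0 → ∃ α β y : ZMod p, (α = ε ∨ α = ε') ∧ (β = δ ∨ β = δ') ∧
        (g : Mat p 2) = !![α, 0; y, β]) ∧
      ∀ F ∈ levelSubmodule p 2 1, ∑ g, lam g * F g = 0 := by
  refine ⟨fun g =>
      (∑ y : ZMod p, if (g : Mat p 2) = !![ε, 0; y, δ] then (1 : ℂ) else 0)
      - (∑ y : ZMod p, if (g : Mat p 2) = !![ε', 0; y, δ] then (1 : ℂ) else 0)
      - (∑ y : ZMod p, if (g : Mat p 2) = !![ε, 0; y, δ'] then (1 : ℂ) else 0)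
      + (∑ y : ZMod p, if (g : Mat p 2) = !![ε', 0; y, δ'] then (1 : ℂ) else 0), ?_, ?_, ?_⟩
  · intro h
    have hd : Matrix.det !![ε, (0 : ZMod p); 0, δ] ≠ 0 := by
      rw [Matrix.det_fin_two_of]; simpa using And.intro hε hδ
    have h0 := congrFun h (Matrix.GeneralLinearGroup.mkOfDetNeZero _ hd)
    have hc : ((Matrix.GeneralLinearGroup.mkOfDetNeZero _ hd : GLm p 2) : Mat p 2) =
        !![ε, 0; 0, δ] := rfl
    simp only [hc, lcell_eq_iff, Pi.zero_apply] at h0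
    simp [hεε', hδδ', Finset.sum_ite_eq] at h0
  · intro g hg
    by_contra hne
    apply hg
    have h0 : ∀ α β : ZMod p, (α = ε ∨ α = ε') → (β = δ ∨ β = δ') →
        (∑ y : ZMod p, if (g : Mat p 2) = !![α, 0; y, β] then (1 : ℂ) else 0) = 0 := by
      intro α β hα hβ
      exact Finset.sum_eq_zero fun y _ => if_neg fun h => hne ⟨α, β, y, hα, hβ, h⟩
    simp only [h0 ε δ (Or.inl rfl) (Or.inl rfl), h0 ε' δ (Or.inr rfl) (Or.inl rfl),
      h0 ε δ' (Or.inl rfl) (Or.inr rfl), h0 ε' δ' (Or.inr rfl) (Or.inr rfl), sub_zero, add_zero]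
  · intro F hF
    obtain ⟨c, hc, hFc⟩ := mem_levelSubmodule_iff.mp hF
    have hF' : F = fourierFn c := funext hFc
    subst hF'
    simp only [sub_mul, add_mul, Finset.sum_sub_distrib, Finset.sum_add_distrib]
    rw [lcell_push ε δ (mul_ne_zero hε hδ) c, lcell_push ε' δ (mul_ne_zero hε' hδ) c,
      lcell_push ε δ' (mul_ne_zero hε hδ') c, lcell_push ε' δ' (mul_ne_zero hε' hδ') c,
      ← Finset.sum_sub_distrib, ← Finset.sum_sub_distrib, ← Finset.sum_add_distrib]
    refine Finset.sum_eq_zero fun M _ => ?_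
    rw [← mul_sub, ← mul_sub, ← mul_add]
    by_cases hM : M.det = 0
    · rw [lcell_bracket M hM, mul_zero]
    · rw [hc M (one_lt_rank_of_det_ne_zero M hM), zero_mul]


/-- Lower cells from the LEFT factor (`U⁻ ≤ Hᵢ`). -/
theorem lcell_of_left {Hi Hj : Subgroup (GLm p 2)}
    (hL : ∀ v : GLm p 2, (v : Mat p 2) 0 1 = 0 → (v : Mat p 2) 0 0 = 1 → (v : Mat p 2) 1 1 = 1 →
      v ∈ Hi)
    {α β : ZMod p} (hα : α ≠ 0)
    (hdiag : ∃ a ∈ Hi, ∃ b ∈ Hj, ((a * b : GLm p 2) : Mat p 2) = !![α, 0; 0, β]) (y : ZMod p) :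
    ∃ a ∈ Hi, ∃ b ∈ Hj, ((a * b : GLm p 2) : Mat p 2) = !![α, 0; y, β] := by
  obtain ⟨a, ha, b, hb, hab⟩ := hdiag
  obtain ⟨v, hv⟩ : ∃ v : GLm p 2, (v : Mat p 2) = !![1, 0; y / α, 1] :=
    ⟨Matrix.GeneralLinearGroup.mkOfDetNeZero _ (by rw [Matrix.det_fin_two_of]; simp), rfl⟩
  refine ⟨v * a, Hi.mul_mem (hL v (by simp [hv]) (by simp [hv]) (by simp [hv])) ha, b, hb, ?_⟩
  rw [mul_assoc, Units.val_mul, hab, hv, Matrix.mul_fin_two]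
  ext i j
  fin_cases i <;> fin_cases j <;> simp [div_mul_cancel₀ _ hα]


/-- Lower cells from the RIGHT factor (`U⁻ ≤ Hⱼ`). -/
theorem lcell_of_right {Hi Hj : Subgroup (GLm p 2)}
    (hL : ∀ v : GLm p 2, (v : Mat p 2) 0 1 = 0 → (v : Mat p 2) 0 0 = 1 → (v : Mat p 2) 1 1 = 1 →
      v ∈ Hj)
    {α β : ZMod p} (hβ : β ≠ 0)
    (hdiag : ∃ a ∈ Hi, ∃ b ∈ Hj, ((a * b : GLm p 2) : Mat p 2) = !![α, 0; 0, β]) (y : ZMod p) :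
    ∃ a ∈ Hi, ∃ b ∈ Hj, ((a * b : GLm p 2) : Mat p 2) = !![α, 0; y, β] := by
  obtain ⟨a, ha, b, hb, hab⟩ := hdiag
  obtain ⟨v, hv⟩ : ∃ v : GLm p 2, (v : Mat p 2) = !![1, 0; y / β, 1] :=
    ⟨Matrix.GeneralLinearGroup.mkOfDetNeZero _ (by rw [Matrix.det_fin_two_of]; simp), rfl⟩
  refine ⟨a, ha, b * v, Hj.mul_mem hb (hL v (by simp [hv]) (by simp [hv]) (by simp [hv])), ?_⟩
  rw [← mul_assoc, Units.val_mul, hab, hv, Matrix.mul_fin_two]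
  ext i j
  fin_cases i <;> fin_cases j <;> simp [mul_div_cancel₀ _ hβ]


/-- **RECTANGLE LAW, pair `(H₁, H₂)`, lower cells.** -/
theorem no_idTest_lrect₁₂ {H₁ H₂ H₃ : Subgroup (GLm p 2)} (htpp : SubgroupTPP H₁ H₂ H₃)
    {ε ε' δ δ' : ZMod p} (hε : ε ≠ 0) (hε' : ε' ≠ 0) (hδ : δ ≠ 0) (hδ' : δ' ≠ 0)
    (hεε' : ε ≠ ε') (hδδ' : δ ≠ δ')
    (hcell : ∀ α β : ZMod p, (α = ε ∨ α = ε') → (β = δ ∨ β = δ') → ∀ y : ZMod p,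
      ∃ a ∈ H₁, ∃ b ∈ H₂, ((a * b : GLm p 2) : Mat p 2) = !![α, 0; y, β]) :
    ¬ ∃ f ∈ levelSubmodule p 2 1, f 1 = 1 ∧
      ∀ a ∈ H₁, ∀ b ∈ H₂, ∀ c ∈ H₃, a * b * c ≠ 1 → f (a * b * c) = 0 := by
  obtain ⟨lam, h1, hsupp, hann⟩ := exists_lrect_annihilator hε hε' hδ hδ' hεε' hδδ'
  refine no_idTest_of_ne_zero_annihilator htpp lam h1 hann (Or.inl fun g hg => ?_)
  obtain ⟨α, β, y, hα, hβ, hgy⟩ := hsupp g hg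
  obtain ⟨a, ha, b, hb, hab⟩ := hcell α β hα hβ y
  exact ⟨a, ha, b, hb, Units.ext (hgy.trans hab.symm)⟩


/-- **RECTANGLE LAW, pair `(H₁, H₃)`, lower cells.** -/
theorem no_idTest_lrect₁₃ {H₁ H₂ H₃ : Subgroup (GLm p 2)} (htpp : SubgroupTPP H₁ H₂ H₃)
    {ε ε' δ δ' : ZMod p} (hε : ε ≠ 0) (hε' : ε' ≠ 0) (hδ : δ ≠ 0) (hδ' : δ' ≠ 0)
    (hεε' : ε ≠ ε') (hδδ' : δ ≠ δ')
    (hcell : ∀ α β : ZMod p, (α = ε ∨ α = ε') → (β = δ ∨ β = δ') → ∀ y : ZMod p,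
      ∃ a ∈ H₁, ∃ c ∈ H₃, ((a * c : GLm p 2) : Mat p 2) = !![α, 0; y, β]) :
    ¬ ∃ f ∈ levelSubmodule p 2 1, f 1 = 1 ∧
      ∀ a ∈ H₁, ∀ b ∈ H₂, ∀ c ∈ H₃, a * b * c ≠ 1 → f (a * b * c) = 0 := by
  obtain ⟨lam, h1, hsupp, hann⟩ := exists_lrect_annihilator hε hε' hδ hδ' hεε' hδδ'
  refine no_idTest_of_ne_zero_annihilator htpp lam h1 hann (Or.inr (Or.inl fun g hg => ?_))
  obtain ⟨α, β, y, hα, hβ, hgy⟩ := hsupp g hg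
  obtain ⟨a, ha, c, hc, hac⟩ := hcell α β hα hβ y
  exact ⟨a, ha, c, hc, Units.ext (hgy.trans hac.symm)⟩


/-- **RECTANGLE LAW, pair `(H₂, H₃)`, lower cells.** -/
theorem no_idTest_lrect₂₃ {H₁ H₂ H₃ : Subgroup (GLm p 2)} (htpp : SubgroupTPP H₁ H₂ H₃)
    {ε ε' δ δ' : ZMod p} (hε : ε ≠ 0) (hε' : ε' ≠ 0) (hδ : δ ≠ 0) (hδ' : δ' ≠ 0)
    (hεε' : ε ≠ ε') (hδδ' : δ ≠ δ')
    (hcell : ∀ α β : ZMod p, (α = ε ∨ α = ε') → (β = δ ∨ β = δ') → ∀ y : ZMod p,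
      ∃ b ∈ H₂, ∃ c ∈ H₃, ((b * c : GLm p 2) : Mat p 2) = !![α, 0; y, β]) :
    ¬ ∃ f ∈ levelSubmodule p 2 1, f 1 = 1 ∧
      ∀ a ∈ H₁, ∀ b ∈ H₂, ∀ c ∈ H₃, a * b * c ≠ 1 → f (a * b * c) = 0 := by
  obtain ⟨lam, h1, hsupp, hann⟩ := exists_lrect_annihilator hε hε' hδ hδ' hεε' hδδ'
  refine no_idTest_of_ne_zero_annihilator htpp lam h1 hann (Or.inr (Or.inr fun g hg => ?_))
  obtain ⟨α, β, y, hα, hβ, hgy⟩ := hsupp g hg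
  obtain ⟨b, hb, c, hc, hbc⟩ := hcell α β hα hβ y
  exact ⟨b, hb, c, hc, Units.ext (hgy.trans hbc.symm)⟩


/-- The sign rectangle `{±1} × {±1}` from a non-scalar sign `s ∈ H₁` and the half-turn
`-I ∈ Hⱼ`: every `diag(α, β)`, `α, β ∈ {1, -1}`, is a product `a b`, `a ∈ H₁`, `b ∈ Hⱼ`. -/
theorem rect_of_halfturn {H₁ Hj : Subgroup (GLm p 2)} {s z : GLm p 2} (hs : s ∈ H₁)
    (hsgn : (s : Mat p 2) = !![1, 0; 0, -1] ∨ (s : Mat p 2) = !![-1, 0; 0, 1]) (hz : z ∈ Hj)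
    (hzI : (z : Mat p 2) = !![-1, 0; 0, -1]) :
    ∀ α β : ZMod p, (α = 1 ∨ α = -1) → (β = 1 ∨ β = -1) →
      ∃ a ∈ H₁, ∃ b ∈ Hj, ((a * b : GLm p 2) : Mat p 2) = !![α, 0; 0, β] := by
  have hmul : ∀ a b : GLm p 2, ∀ x₀ x₁ y₀ y₁ : ZMod p, (a : Mat p 2) = !![x₀, 0; 0, x₁] →
      (b : Mat p 2) = !![y₀, 0; 0, y₁] →
      ((a * b : GLm p 2) : Mat p 2) = !![x₀ * y₀, 0; 0, x₁ * y₁] := by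
    intro a b x₀ x₁ y₀ y₁ ha hb
    rw [Units.val_mul, ha, hb, Matrix.mul_fin_two]
    ext i j; fin_cases i <;> fin_cases j <;> simp
  have h1 : ((1 : GLm p 2) : Mat p 2) = !![1, 0; 0, 1] := by
    rw [Units.val_one]; ext i j; fin_cases i <;> fin_cases j <;> simp
  intro α β hα hβ
  rcases hsgn with hsv | hsv
  · rcases hα with hα | hα <;> rcases hβ with hβ | hβ <;> rw [hα, hβ]
    · exact ⟨1, H₁.one_mem, 1, Hj.one_mem, by rw [hmul 1 1 1 1 1 1 h1 h1]; simp⟩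
    · exact ⟨s, hs, 1, Hj.one_mem, by rw [hmul s 1 1 (-1) 1 1 hsv h1]; simp⟩
    · exact ⟨s, hs, z, hz, by rw [hmul s z 1 (-1) (-1) (-1) hsv hzI]; simp⟩
    · exact ⟨1, H₁.one_mem, z, hz, by rw [hmul 1 z 1 1 (-1) (-1) h1 hzI]; simp⟩
  · rcases hα with hα | hα <;> rcases hβ with hβ | hβ <;> rw [hα, hβ]
    · exact ⟨1, H₁.one_mem, 1, Hj.one_mem, by rw [hmul 1 1 1 1 1 1 h1 h1]; simp⟩
    · exact ⟨s, hs, z, hz, by rw [hmul s z (-1) 1 (-1) (-1) hsv hzI]; simp⟩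
    · exact ⟨s, hs, 1, Hj.one_mem, by rw [hmul s 1 (-1) 1 1 1 hsv h1]; simp⟩
    · exact ⟨1, H₁.one_mem, z, hz, by rw [hmul 1 z 1 1 (-1) (-1) h1 hzI]; simp⟩

/-- **HALF-TURN LAW, partner `H₂`** (`p ≠ 2`).  If `H₁ ⊇ U⁺` contains `diag(1,-1)` or
`diag(-1,1)` and `-I ∈ H₂`, no subgroup-TPP triple `(H₁, H₂, H₃)` of `GL_2(𝔽_p)` satisfies the
identity-design clause of `SubgroupIdentityDesigns` at level `1`. -/
theorem no_levelOne_design_halfturn₁₂ (hp2 : p ≠ 2) {H₁ H₂ H₃ : Subgroup (GLm p 2)}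
    (hU : ∀ u : GLm p 2, (u : Mat p 2) 1 0 = 0 → (u : Mat p 2) 0 0 = 1 → (u : Mat p 2) 1 1 = 1 →
      u ∈ H₁)
    {s z : GLm p 2} (hs : s ∈ H₁)
    (hsgn : (s : Mat p 2) = !![1, 0; 0, -1] ∨ (s : Mat p 2) = !![-1, 0; 0, 1]) (hz : z ∈ H₂)
    (hzI : (z : Mat p 2) = !![-1, 0; 0, -1]) (htpp : SubgroupTPP H₁ H₂ H₃) :
    ¬ ∃ c : Mat p 2 → ℂ, (∀ M, 1 < M.rank → c M = 0) ∧
        (∑ M, c M * ZMod.stdAddChar (Matrix.trace (M * ((1 : GLm p 2) : Mat p 2)))) = 1 ∧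
        ∀ a ∈ H₁, ∀ b ∈ H₂, ∀ g ∈ H₃, a * b * g ≠ 1 →
          (∑ M, c M *
            ZMod.stdAddChar (Matrix.trace (M * ((a * b * g : GLm p 2) : Mat p 2)))) = 0 := by
  rintro ⟨c, hc, hc1, hc0⟩
  have hchar : ringChar (ZMod p) ≠ 2 := by rw [ZMod.ringChar_zmod_n]; exact hp2
  have hne1 : (-1 : ZMod p) ≠ 1 := Ring.neg_one_ne_one_of_char_ne_two hchar
  have hm0 : (-1 : ZMod p) ≠ 0 := neg_ne_zero.mpr one_ne_zero
  have hrect := rect_of_halfturn hs hsgn hz hzI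
  refine no_idTest_urect₁₂ htpp one_ne_zero hm0 one_ne_zero hm0 hne1.symm hne1.symm
    (fun α β hα hβ x => ucell_of_left hU
      (by rcases hβ with hβ | hβ <;> rw [hβ]; exacts [one_ne_zero, hm0]) (hrect α β hα hβ) x)
    ⟨fourierFn c, fourierFn_mem_levelSubmodule hc, hc1, fun a ha b hb g hg hne => ?_⟩
  exact hc0 a ha b hb g hg hne

/-- **HALF-TURN LAW, partner `H₃`** (`p ≠ 2`) — e.g. the third member `S` of a frame whose
`p`-member `K₁ = U⁺ ⋊ ⟨diag(1,-1)⟩` is sign-decorated: `-I ∉ S`. -/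
theorem no_levelOne_design_halfturn₁₃ (hp2 : p ≠ 2) {H₁ H₂ H₃ : Subgroup (GLm p 2)}
    (hU : ∀ u : GLm p 2, (u : Mat p 2) 1 0 = 0 → (u : Mat p 2) 0 0 = 1 → (u : Mat p 2) 1 1 = 1 →
      u ∈ H₁)
    {s z : GLm p 2} (hs : s ∈ H₁)
    (hsgn : (s : Mat p 2) = !![1, 0; 0, -1] ∨ (s : Mat p 2) = !![-1, 0; 0, 1]) (hz : z ∈ H₃)
    (hzI : (z : Mat p 2) = !![-1, 0; 0, -1]) (htpp : SubgroupTPP H₁ H₂ H₃) :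
    ¬ ∃ c : Mat p 2 → ℂ, (∀ M, 1 < M.rank → c M = 0) ∧
        (∑ M, c M * ZMod.stdAddChar (Matrix.trace (M * ((1 : GLm p 2) : Mat p 2)))) = 1 ∧
        ∀ a ∈ H₁, ∀ b ∈ H₂, ∀ g ∈ H₃, a * b * g ≠ 1 →
          (∑ M, c M *
            ZMod.stdAddChar (Matrix.trace (M * ((a * b * g : GLm p 2) : Mat p 2)))) = 0 := by
  rintro ⟨c, hc, hc1, hc0⟩
  have hchar : ringChar (ZMod p) ≠ 2 := by rw [ZMod.ringChar_zmod_n]; exact hp2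
  have hne1 : (-1 : ZMod p) ≠ 1 := Ring.neg_one_ne_one_of_char_ne_two hchar
  have hm0 : (-1 : ZMod p) ≠ 0 := neg_ne_zero.mpr one_ne_zero
  have hrect := rect_of_halfturn hs hsgn hz hzI
  refine no_idTest_urect₁₃ htpp one_ne_zero hm0 one_ne_zero hm0 hne1.symm hne1.symm
    (fun α β hα hβ x => ucell_of_left hU
      (by rcases hβ with hβ | hβ <;> rw [hβ]; exacts [one_ne_zero, hm0]) (hrect α β hα hβ) x)
    ⟨fourierFn c, fourierFn_mem_levelSubmodule hc, hc1, fun a ha b hb g hg hne => ?_⟩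
  exact hc0 a ha b hb g hg hne

end RectangleLawLower

end Summit.MatrixMultiplication.MatrixMultiplication.Theorems.SubgroupIdentityDesigns.Negative

end
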